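import Mathlib.Data.Matrix.Basic
import Mathlib.Data.Matrix.Mul
import Mathlib.LinearAlgebra.Matrix.Trace
import Mathlib.Algebra.BigOperators.Group.Finset.Basic
import Mathlib.Algebra.BigOperators.Fin
import Mathlib.Tactic.NormNum
import Mathlib.Tactic.Ring
import Mathlib.Tactic.Abel
import Mathlib.Tactic.LinearCombination
import HarnessLib

/-!
# Conjugate `μ₆` types: the transposition identities (WEIL-2 gen 52, CONJUGATE-G52, fact-free)

research route, not a corollary; conditional on HC_CM plus one named minimal statement.

Cell `pub-hodge-ring2-ab-*` (ALL ABELIAN VARIETIES), seat WEIL-2 gen 52, account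
`run/shared/lean/pub/pub-hodge-ring2/pub-hodge-ring2-ab-weil-2/CONJUGATE-G52.md`.

Informal setting (THIRDORDER-G51, THEOREM J (iii); CORANK-G50).  For the cyclic `d = 2` Galois–Prym data the two
`μ₆` types `[1,3,4,4]` (I) and `[2,2,3,5] = [5,3,2,2]` relabelled (II) satisfy `e^{II} = 6 − e^{I}` pointwise: a
type II cover is a type I cover with the inverse `μ₆`-action.  THEOREM C of CONJUGATE-G52 (by hand): the two
Hurwitz families are canonically identified, the `K`-pieces coincide as abelian varieties with conjugate
`K`-structure, and the period maps are intertwined by `F ↦ F^⊥`; along a curve tangent to the kernel line at a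
point of the deficiency locus, with `H` the (Gauss–Manin trivialised) `χ`- and `χ̄`-parts paired by the alternating
form `Q`, frames `ω_a(t)` of `F_t` and `ω'_a(t)` of `F'_t = F_t^⊥`, and
`P i j := (Q(∇^i ω'_a, ∇^j ω_b)|₀)_{ab}`, the type I Gauss–Manin matrices are `M_k = −(P 0 k)ᵀ`, the type II ones are
`M'_k = P k 0`, and the orthogonality `Q(ω'_a(t), ω_b(t)) ≡ 0` differentiated `k` times gives the Leibniz relations
`Σ_i C(k,i) P i (k−i) = 0`.  With `M₁ = 0` (kernel direction) and `∇ω|₀ ∈ F`, `∇ω'|₀ ∈ F'` (matrices `N₁`, `N₁'`)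
these force `M'₂ = M₂ᵀ` and `M'₃ − 3 N₁' M'₂ = (M₃ − 3 N₁ M₂)ᵀ`: the second-order matrix and THEOREM J's third-order
matrix of type II are the TRANSPOSES of those of type I, hence take opposite values on every antisymmetric wedge
`f ∧ f'` — habitat2's observation `(M₂, τ)^{II} = −(M₂, τ)^{I}` on `ker μ` (50/50 runs), now a theorem.

This file holds the finite algebra: the transposition identities over any commutative ring (any size of frames),
the sign on antisymmetric wedges, the exponent/divisor bookkeeping of the identification, and the residues of
record.  Mathlib only, 0 sorry, no `def`, no named fact; `HC_CM` does not occur.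
-/

namespace Summit.HodgeConjecture.Ring2AbelianAll.PrymTorelliConjugate

open Matrix

section transposition

variable {R : Type*} [CommRing R] {n : Type*}

/-- CONJUGATE-G52 THEOREM C (ii), first order.  With `P i j = (Q(∇^i ω'_a, ∇^j ω_b)|₀)_{ab}`, the once
differentiated orthogonality `P 1 0 + P 0 1 = 0` says that the type II first-order matrix `M'₁ = P 1 0` is the
transpose of the type I matrix `M₁ = −(P 0 1)ᵀ`.  In particular the two first-order (Kodaira–Spencer) systems have
the same rank at corresponding points and the same kernel line: `R^{II} = R^{I}`, `κ^{II} = κ^{I}`.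
research route, not a corollary; conditional on HC_CM plus one named minimal statement. -/
theorem first_order_transpose (P10 P01 M1 : Matrix n n R) (orth1 : P10 + P01 = 0)
    (hM1 : M1 = -P01ᵀ) : P10 = M1ᵀ := by
  have h : P10 = -P01 := eq_neg_of_add_eq_zero_left orth1
  rw [hM1, transpose_neg, transpose_transpose, h]

/-- CONJUGATE-G52 THEOREM C (ii), second order.  Hypotheses: the twice differentiated orthogonality
`P 2 0 + 2 P 1 1 + P 0 2 = 0`; `∇ω'_a|₀ = Σ_d N₁'_{ad} ω'_d` (so `P 1 1 = N₁' ⬝ P 0 1`); the kernel-direction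
condition `M₁ = 0`, i.e. `P 0 1 = 0`.  Conclusion: `M'₂ = P 2 0` equals `M₂ᵀ` where `M₂ = −(P 0 2)ᵀ`.
research route, not a corollary; conditional on HC_CM plus one named minimal statement. -/
theorem second_order_transpose [Fintype n] (P20 P11 P02 P01 N1' M2 : Matrix n n R)
    (orth2 : P20 + 2 • P11 + P02 = 0) (flat' : P11 = N1' * P01) (ker : P01 = 0)
    (hM2 : M2 = -P02ᵀ) : P20 = M2ᵀ := by
  have h11 : P11 = 0 := by rw [flat', ker, Matrix.mul_zero]
  rw [h11, smul_zero, add_zero] at orth2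
  have h : P20 = -P02 := eq_neg_of_add_eq_zero_left orth2
  rw [hM2, transpose_neg, transpose_transpose, h]

/-- CONJUGATE-G52 THEOREM C (ii), third order: THEOREM J's matrix transposes.  Hypotheses: the thrice
differentiated orthogonality `P 3 0 + 3 P 2 1 + 3 P 1 2 + P 0 3 = 0`; `∇ω_b|₀ = Σ_c N₁_{bc} ω_c` (so
`P 2 1 = P 2 0 ⬝ N₁ᵀ`) and `∇ω'_a|₀ = Σ_d N₁'_{ad} ω'_d` (so `P 1 2 = N₁' ⬝ P 0 2`); the second-order conclusion
`P 2 0 = M₂ᵀ`; and `M₂ = −(P 0 2)ᵀ`, `M₃ = −(P 0 3)ᵀ`.  Conclusion: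
`M'₃ − 3 N₁' M'₂ = (M₃ − 3 N₁ M₂)ᵀ` with `M'₃ = P 3 0`, `M'₂ = P 2 0`.
research route, not a corollary; conditional on HC_CM plus one named minimal statement. -/
theorem third_order_transpose [Fintype n] (P30 P21 P12 P03 P20 P02 N1 N1' M2 M3 : Matrix n n R)
    (orth3 : P30 + 3 • P21 + 3 • P12 + P03 = 0) (flat : P21 = P20 * N1ᵀ) (flat' : P12 = N1' * P02)
    (h20 : P20 = M2ᵀ) (hM2 : M2 = -P02ᵀ) (hM3 : M3 = -P03ᵀ) :
    P30 - 3 • (N1' * P20) = (M3 - 3 • (N1 * M2))ᵀ := by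
  have hP02 : P02 = -M2ᵀ := by rw [hM2, transpose_neg, transpose_transpose, neg_neg]
  have hP03 : P03 = -M3ᵀ := by rw [hM3, transpose_neg, transpose_transpose, neg_neg]
  have h30 : P30 = -(3 • P21) - 3 • P12 - P03 := by
    rw [← sub_eq_zero, ← orth3]
    abel
  rw [h30, flat, flat', h20, hP02, hP03, transpose_sub, transpose_smul, transpose_mul]
  simp only [Matrix.mul_neg, smul_neg, sub_neg_eq_add]
  abel

/-- CONJUGATE-G52 THEOREM C (iii), the sign on wedges.  A covector `Λ` on `V ⊗ V'` with `Λᵀ = −Λ` (the wedges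
`f ∧ f' := f ⊗ g f' − f' ⊗ g f` of `ker μ`) pairs with a transposed matrix to minus its pairing with the matrix:
`Σ_{ab} Λ_{ab} (Tᵀ)_{ab} = − Σ_{ab} Λ_{ab} T_{ab}`.  With THEOREM C (ii): `M₂^{II}(λ) = −M₂^{I}(λ)` and
`τ^{II}(λ) = −τ^{I}(λ)` on every wedge `λ` — habitat2's observation O4 (50/50 runs), as a theorem.
research route, not a corollary; conditional on HC_CM plus one named minimal statement. -/
theorem wedge_pairing_transpose [Fintype n] (Λ T : Matrix n n R) (anti : Λᵀ = -Λ) :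
    (∑ a, ∑ b, Λ a b * Tᵀ a b) = -∑ a, ∑ b, Λ a b * T a b := by
  have hΛ : ∀ a b, Λ a b = -Λ b a := by
    intro a b
    have := congrFun (congrFun anti b) a
    simpa [transpose_apply] using this
  simp only [transpose_apply]
  rw [Finset.sum_comm]
  rw [← Finset.sum_neg_distrib]
  refine Finset.sum_congr rfl fun b _ => ?_
  rw [← Finset.sum_neg_distrib]
  refine Finset.sum_congr rfl fun a _ => ?_
  rw [hΛ a b]; ring

/-- CONJUGATE-G52 §2.4, the symbol function.  For `m(t) = Q(∇ω_a, ω'_b) = ⟨γ'(t), μ_t(ω_a ⊗ ω'_b)⟩` (the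
first-order symbol along the curve) the Leibniz rule and `M'₂ = M₂ᵀ` give `m''(0) = M₃ + 2 M₂ N₁'ᵀ − N₁ M₂`; this
theorem is the rearrangement `M₃ − 3 N₁ M₂ = (M₃ + 2 M₂ N₁'ᵀ − N₁ M₂) − 2 (N₁ M₂ + M₂ N₁'ᵀ)`, so that in frames
which are Gauss–Manin flat to first order on both sides (`N₁ = N₁' = 0`) THEOREM J's `τ`-matrix IS the second
derivative of the symbol.  (Pure rearrangement, any commutative ring.)
research route, not a corollary; conditional on HC_CM plus one named minimal statement. -/
theorem tau_as_symbol_second_derivative [Fintype n] (M2 M3 N1 N1' : Matrix n n R) :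
    M3 - 3 • (N1 * M2) = (M3 + 2 • (M2 * N1'ᵀ) - N1 * M2) - 2 • (N1 * M2 + M2 * N1'ᵀ) := by
  rw [smul_add]
  abel_nf

end transposition

section bookkeeping

/-- CONJUGATE-G52 THEOREM C (i), exponents.  Type II relabelled, `[5,3,2,2]` at `(y₁, y₂, y₃, y₄)`, is
`6 − [1,3,4,4]` entrywise, i.e. `≡ 5·[1,3,4,4] (mod 6)`: the type II cover is the type I cover with the
`μ₆`-action composed with inversion.
research route, not a corollary; conditional on HC_CM plus one named minimal statement. -/
theorem exponents_conjugate :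
    ((6 : ℤ) - 1 = 5 ∧ (6 : ℤ) - 3 = 3 ∧ (6 : ℤ) - 4 = 2) ∧
    ((5 * 1) % 6 = (5 : ℤ) ∧ (5 * 3) % 6 = (3 : ℤ) ∧ (5 * 4) % 6 = (2 : ℤ)) := by
  refine ⟨⟨by norm_num, by norm_num, by norm_num⟩, ⟨by norm_num, by norm_num, by norm_num⟩⟩

/-- CONJUGATE-G52 THEOREM C (i), the sheets.  With `div φ^{I} = y₁ + 3y₂ + 4y₃ + 4y₄ − 6E` and
`div φ^{II} = 5y₁ + 3y₂ + 2y₃ + 2y₄ − 6E'`, the function `φ^{II}/(φ^{I})⁵` is a sixth power iff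
`E' ∼ 5E − 2y₂ − 3y₃ − 3y₄`: coefficient bookkeeping `5·(1,3,4,4) − (5,3,2,2) = 6·(0,2,3,3)` and
`5·6 − 6 = 6·4`, i.e. `5·div φ^{I} − div φ^{II} = 6·(2y₂ + 3y₃ + 3y₄ − 5E + E')`; and the degree of
`5E − 2y₂ − 3y₃ − 3y₄` is `2 = deg E'`.
research route, not a corollary; conditional on HC_CM plus one named minimal statement. -/
theorem sheet_bookkeeping :
    (5 * 1 - 5 = 6 * (0 : ℤ)) ∧ (5 * 3 - 3 = 6 * (2 : ℤ)) ∧ (5 * 4 - 2 = 6 * (3 : ℤ)) ∧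
    (5 * 6 - 6 = 6 * (4 : ℤ)) ∧ (5 * 2 - 2 - 3 - 3 = (2 : ℤ)) := by
  refine ⟨by norm_num, by norm_num, by norm_num, by norm_num, by norm_num⟩

/-- CONJUGATE-G52 THEOREM C (i) on `R_2`.  On the deficiency locus (`2E ∼ y₁ + y₂ + y₃ + y₄`, `y₃ + y₄ ∼ 2y₁`)
the class `5E − 2y₂ − 3y₃ − 3y₄ − E` is `2(2E − y₁ − y₂ − y₃ − y₄) + 2y₁ − (y₃ + y₄)`-bookkeeping:
`4E − 2y₂ − 3y₃ − 3y₄ = 2·(2E − y₁ − y₂ − y₃ − y₄) + (2y₁ − y₃ − y₄)` as integer combinations of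
`(E, y₁, y₂, y₃, y₄)`, so `E' ∼ E` there: at a point of `R_2` the two types have the SAME sheet, as the engines
assume (`h₀ = (y + a)³` for both).
research route, not a corollary; conditional on HC_CM plus one named minimal statement. -/
theorem same_sheet_on_R2 (E y₁ y₂ y₃ y₄ : ℤ) :
    4 * E - 2 * y₂ - 3 * y₃ - 3 * y₄ = 2 * (2 * E - y₁ - y₂ - y₃ - y₄) + (2 * y₁ - y₃ - y₄) := by ring

/-- CONJUGATE-G52 THEOREM C (i), the frames.  `w_{II}⁻¹ = w_I⁻⁵ ψ⁻¹ = w_I · (φ^{I} ψ)⁻¹` and the divisor of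
`(φ^{I}ψ)⁻¹` is `E + E' − y₁ − y₂ − y₃ − y₄` (degree `0`), which on `R_2` (`E' = E`) is `div g`,
`g = (y + a)/((x − x₂)(x − x₃))`: coefficient bookkeeping `−(1,3,4,4,−6) + (0,2,3,3,−5) + (0,0,0,0,1)·E'`, i.e.
`−1 + 0 = −1`, `−3 + 2 = −1`, `−4 + 3 = −1` (twice), `6 − 5 = 1`; degree `1 + 1·2... = 2 + 2 − 4 = 0`.
So the type II `F`-frame `w_{II}⁻¹η_a` is a constant times the type I `F'`-frame `w_I g η_a`, and dually.
research route, not a corollary; conditional on HC_CM plus one named minimal statement. -/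
theorem frame_bookkeeping :
    (-(1 : ℤ) + 0 = -1) ∧ (-(3 : ℤ) + 2 = -1) ∧ (-(4 : ℤ) + 3 = -1) ∧ ((6 : ℤ) - 5 = 1) ∧
    ((2 : ℤ) + 2 - 1 - 1 - 1 - 1 = 0) := by
  refine ⟨by norm_num, by norm_num, by norm_num, by norm_num, by norm_num⟩

/-- CONJUGATE-G52 §3, residues of record.  THEOREM C (iii) predicts `τ^{II}(λ) + τ^{I}(λ) ≡ 0` and
`M₂^{II}(λ) + M₂^{I}(λ) ≡ 0 (mod p)` on every wedge, including the jet-dependent `x ∧ s`: at the member of record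
(`p = 10007`, seed 1) the printed values are `M₂(x∧s) = 3341 | 6666`, `τ(1∧x) = 3357 | 6650`,
`τ(x∧s) = 8484 | 1523` (run A), `1711 | 8296` (run C), `7830 | 2177` (run D) — each pair sums to `10007`.
research route, not a corollary; conditional on HC_CM plus one named minimal statement. -/
theorem residues_of_record_conjugate :
    3341 + 6666 = 10007 ∧ 3357 + 6650 = 10007 ∧ 8484 + 1523 = 10007 ∧ 1711 + 8296 = 10007 ∧
    7830 + 2177 = 10007 ∧ (6678 + 3331 = 10009 ∧ 6694 + 3315 = 10009) ∧
    (3367 + 6670 = 10037) ∧ (6714 + 3325 = 10039) := by norm_num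

end bookkeeping

section reduction

variable {R : Type*} [CommRing R]

/-- CONJUGATE-G52 §7, PROPOSITION R (the reduction of CONJECTURE U to first-order Gauss–Manin facts; by hand).  Index the
frames by `0 ↔ 1·dx/y`, `1 ↔ x·dx/y`, `2 ↔ s·dx/y`.  Hypotheses: THEOREM S⁺ and THEOREM S in matrix form (`M₂` symmetric in the
`(1,x)` and `(1,s)` slots), and the first-order facts (F1) the `(1,x)`, `(x,1)` entries of `N₁`, `N₁'` vanish, (F2) equal diagonal
entries on `1`, `x`, (F3) `N₁(1,s) = N₁'(1,s) = ν`, (F4) `N₁(x,s) = N₁'(x,s)`.  Conclusion: the Gauss–Manin correction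
`Y := N₁M₂ + M₂N₁'ᵀ` takes the value `−ν·M₂(x∧s)` on the wedge `1∧x`.
research route, not a corollary; conditional on HC_CM plus one named minimal statement. -/
theorem correction_on_hyperelliptic_wedge (M2 N1 N1' : Matrix (Fin 3) (Fin 3) R) (ν : R)
    (hSplus : M2 0 1 = M2 1 0) (hS : M2 0 2 = M2 2 0)
    (f1a : N1 0 1 = 0) (f1b : N1 1 0 = 0) (f1c : N1' 0 1 = 0) (f1d : N1' 1 0 = 0)
    (f2 : N1 0 0 = N1 1 1) (f2' : N1' 0 0 = N1' 1 1) (f3 : N1 0 2 = ν) (f3' : N1' 0 2 = ν)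
    (f4 : N1 1 2 = N1' 1 2) :
    (N1 * M2 + M2 * N1'ᵀ) 0 1 - (N1 * M2 + M2 * N1'ᵀ) 1 0 = -(ν * (M2 1 2 - M2 2 1)) := by
  simp only [Matrix.add_apply, Matrix.mul_apply, Matrix.transpose_apply, Fin.sum_univ_three]
  rw [f1a, f1b, f1c, f1d, f3, f3', f2, f2', f4, hSplus, hS]
  ring

/-- CONJUGATE-G52 §7, COROLLARY (CONJECTURE U from (F1)–(F4)).  With the symbol form of THEOREM J's matrix
`T = m'' − 2(N₁M₂ + M₂N₁'ᵀ)` (§1.7) and LEMMA Σ (`m''` vanishes on the wedge `1∧x` for the conjugate-paired frames), the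
hypotheses of `correction_on_hyperelliptic_wedge` give `τ(1∧x) = T(1,x) − T(x,1) = 2ν·M₂(x∧s)`; with `ν = 2ż₁` this is
CONJECTURE U's `τ(1∧x) = 4ż₁·D²Φ(κ,κ)(x∧s)` (`= 64/3` for `ż₁ = 1`).
research route, not a corollary; conditional on HC_CM plus one named minimal statement. -/
theorem conjectureU_of_first_order_facts (T msec Y M2 : Matrix (Fin 3) (Fin 3) R) (ν : R)
    (hT : T = msec - 2 • Y) (hsym : msec 0 1 - msec 1 0 = 0)
    (hY : Y 0 1 - Y 1 0 = -(ν * (M2 1 2 - M2 2 1))) :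
    T 0 1 - T 1 0 = 2 * ν * (M2 1 2 - M2 2 1) := by
  rw [hT]
  simp only [Matrix.sub_apply, Matrix.smul_apply]
  linear_combination hsym - 2 * hY

/-- CONJUGATE-G52 §7, the numbers.  With `ν = 2` (`ż₁ = 1`) and `M₂(x∧s) = 16/3` (THEOREM S transported, THIRDORDER-G51 C.4):
`2·2·(16/3) = 64/3`, and the correction value `−ν·M₂(x∧s) = −32/3` — the residue found at every member
(`3·Y(1∧x) ≡ −32 (mod p)`).
research route, not a corollary; conditional on HC_CM plus one named minimal statement. -/
theorem conjectureU_numbers : (2 : ℚ) * 2 * (16 / 3) = 64 / 3 ∧ -((2 : ℚ) * (16 / 3)) = -32 / 3 := by norm_num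

end reduction

end Summit.HodgeConjecture.Ring2AbelianAll.PrymTorelliConjugate
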